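import Summits.Ventures.PercRepro.MSTightTightCase
import Summits.Ventures.PercRepro.MSTightNoExtraGround

/-!
# The tight case of (R*-M) on a ground set ((F3) of Addendum 37, ground form)

Dossier proofs/MINE1-theoremS.md, Addendum 37 (F3), and proofs/MINE1-RSTARM-PROOF.md §1 (F3), §6.
The tree's `exists_mem_of_tight` (MSTightTightCase.lean) proves the tight case of (R*-M) on the
whole finite type. The merged instance of the proof of (R*-M) proper (Addendum 39, Step 2) lives
on the ground set `u ∪ {m}`, and when its family is tight the witness comes from this case — so it
is needed with an explicit ground set `S : Finset α` (`exists_mem_of_tight_ground`): `L'` a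
down-set containing every singleton of `S`, `T ⊆ 2^S` a TIGHT nonempty family with `S ∖ y ∈ L'`
for every member and exactly `|T| + 1` faces, `u ⊆ S` with `u ∉ L'`, `S ∖ u ∈ L'`, (Sig), (AO).
Then a member of `T` inside `u` lies in `L'`. The proof is that of `exists_mem_of_tight` with
`univ` replaced by `S` (the twin classes of `T` and Theorem S do not depend on the ground set).
-/

namespace PercRepro.MSTight

open Finset
open scoped FinsetFamily

variable {α : Type*} [DecidableEq α] [Fintype α]

/-- In a tight family of subsets of `S` with exactly one face that is not a difference, every
element of a member is its own twin class (every singleton of `S` is a face). -/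
theorem cls_eq_singleton_of_faces_ground {S : Finset α} {L' T : Finset (Finset α)}
    (hsing : ∀ a ∈ S, ({a} : Finset α) ∈ L') (hTS : ∀ y ∈ T, y ⊆ S) {e : Finset α}
    (hfaces : ∀ w, w ∈ (L'.filter fun w => ∃ y ∈ T, w ⊆ y) ↔ w ∈ T \\ T ∨ w = e)
    {t : Finset α} (ht : t ∈ T) {a : α} (ha : a ∈ t) : cls T a = {a} := by
  have hsingle : ∀ b ∈ t, ({b} : Finset α) ∈ T \\ T → cls T b = {b} := by
    intro b _ hb
    apply Subset.antisymm
    · exact cls_subset_of_twinClosed (twinClosed_of_mem_diffs hb) (mem_singleton_self b)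
    · exact singleton_subset_iff.2 (self_mem_cls T b)
  have hfa : ({a} : Finset α) ∈ (L'.filter fun w => ∃ y ∈ T, w ⊆ y) :=
    mem_filter.2 ⟨hsing a (hTS t ht ha), t, ht, singleton_subset_iff.2 ha⟩
  rcases (hfaces _).1 hfa with h | h
  · exact hsingle a ha h
  · -- `{a} = e`: any twin `b` of `a` has `{b}` a face, hence a difference (`{b} ≠ e` unless `b = a`)
    apply Subset.antisymm
    · intro b hb
      have hab : Twin T a b := mem_cls.1 hb
      have hbt : b ∈ t := (hab t ht).1 ha
      have hfb : ({b} : Finset α) ∈ (L'.filter fun w => ∃ y ∈ T, w ⊆ y) :=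
        mem_filter.2 ⟨hsing b (hTS t ht hbt), t, ht, singleton_subset_iff.2 hbt⟩
      rcases (hfaces _).1 hfb with h' | h'
      · have : cls T b = {b} := hsingle b hbt h'
        have hba : a ∈ cls T b := mem_cls.2 hab.symm
        rw [this, mem_singleton] at hba
        rw [hba]; exact mem_singleton_self b
      · rw [← h] at h'
        rw [singleton_inj] at h'
        rw [h']; exact mem_singleton_self a
    · exact singleton_subset_iff.2 (self_mem_cls T a)

/-- **The tight case of (R*-M) on a ground set.** -/
theorem exists_mem_of_tight_ground {S : Finset α} {L' T : Finset (Finset α)}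
    (hdown : ∀ w ∈ L', ∀ w', w' ⊆ w → w' ∈ L') (hsing : ∀ a ∈ S, ({a} : Finset α) ∈ L')
    (hF : Tight T) (hne : T.Nonempty) (hTS : ∀ y ∈ T, y ⊆ S) (hTU : ∀ y ∈ T, S \ y ∈ L')
    (hcard : ((L'.filter fun w => ∃ y ∈ T, w ⊆ y)).card = T.card + 1)
    (u : Finset α) (huS : u ⊆ S) (hu : u ∉ L') (huU : S \ u ∈ L')
    (hsig : ∀ v ∈ L', v ⊆ u → u \ v ∈ L' ∨ ∃ y ∈ T, v ⊆ y)
    (hao : ∃ v₀ ∈ L', v₀ ⊆ u ∧ u \ v₀ ∈ L' ∧ ∀ y ∈ T, ¬ v₀ ⊆ y) :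
    ∃ y ∈ T, y ⊆ u ∧ y ∈ L' := by
  obtain ⟨v₀, hv₀, hv₀u, -, hv₀F⟩ := hao
  have hDsub : T \\ T ⊆ (L'.filter fun w => ∃ y ∈ T, w ⊆ y) :=
    diffs_subset_faces_ground hdown hTS hTU
  -- the extra face `e`
  have hextra : ((L'.filter fun w => ∃ y ∈ T, w ⊆ y) \ (T \\ T)).card = 1 := by
    rw [card_sdiff, inter_eq_left.2 hDsub, hcard, hF]; omega
  obtain ⟨e, he⟩ := card_eq_one.1 hextra
  have hfaces : ∀ w, w ∈ (L'.filter fun w => ∃ y ∈ T, w ⊆ y) ↔ w ∈ T \\ T ∨ w = e := by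
    intro w
    constructor
    · intro hw
      by_cases hwD : w ∈ T \\ T
      · exact Or.inl hwD
      · right
        have : w ∈ (L'.filter fun w => ∃ y ∈ T, w ⊆ y) \ (T \\ T) := mem_sdiff.2 ⟨hw, hwD⟩
        rw [he, mem_singleton] at this
        exact this
    · intro hw
      rcases hw with hw | hw
      · exact hDsub hw
      · rw [hw]
        have : e ∈ (L'.filter fun w => ∃ y ∈ T, w ⊆ y) \ (T \\ T) := by
          rw [he]; exact mem_singleton_self e
        exact (mem_sdiff.1 this).1
  have heD : e ∉ T \\ T := by
    have : e ∈ (L'.filter fun w => ∃ y ∈ T, w ⊆ y) \ (T \\ T) := by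
      rw [he]; exact mem_singleton_self e
    exact (mem_sdiff.1 this).2
  have hef : e ∈ (L'.filter fun w => ∃ y ∈ T, w ⊆ y) := (hfaces e).2 (Or.inr rfl)
  have hempty : (∅ : Finset α) ∈ T \\ T := by
    obtain ⟨t, ht⟩ := hne
    exact mem_diffs.2 ⟨t, ht, t, ht, Finset.sdiff_self t⟩
  have hene : e ≠ ∅ := fun h => heD (h ▸ hempty)
  -- subsets of members are twin-closed, so the differences form a down-set
  have htc : ∀ {t : Finset α}, t ∈ T → ∀ {Z : Finset α}, Z ⊆ t → TwinClosed T Z := by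
    intro t ht Z hZ a b hab haZ
    have hcls := cls_eq_singleton_of_faces_ground hsing hTS hfaces ht (hZ haZ)
    have : b ∈ cls T a := mem_cls.2 hab
    rw [hcls, mem_singleton] at this
    rw [this]; exact haZ
  have hD : IsDownSet (T \\ T) := by
    intro W hW W' hW'
    obtain ⟨t, ht, t', -, rfl⟩ := mem_diffs.1 hW
    have hWflip : t \ t' ∈ flip (Rstar T) T := by
      rw [← diffs_eq_flip_of_tight hF]; exact hW
    rw [diffs_eq_flip_of_tight hF]
    exact mem_flip_of_subset_of_twinClosed (dichotomy_of_tight hF) hWflip hW'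
      (htc ht (hW'.trans sdiff_subset))
  -- Theorem S in its down-closed form, on the ground set `S`
  obtain ⟨M, hMS, L, U, hL, hLN, hU, hUM, hFLU, hDLU⟩ :=
    exists_downSet_upSet_of_tight_of_isDownSet hF hD hTS
  have hLne : L.Nonempty := by
    obtain ⟨t, ht⟩ := hne
    rw [hFLU] at ht
    obtain ⟨x, hx, -, -, -⟩ := mem_sups.1 ht
    exact ⟨x, hx⟩
  have hUne : U.Nonempty := by
    obtain ⟨t, ht⟩ := hne
    rw [hFLU] at ht
    obtain ⟨-, -, z, hz, -⟩ := mem_sups.1 ht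
    exact ⟨z, hz⟩
  have hemptyL : (∅ : Finset α) ∈ L := by
    obtain ⟨x, hx⟩ := hLne
    exact hL x hx ∅ (empty_subset _)
  have hMU : M ∈ U := by
    obtain ⟨z, hz⟩ := hUne
    exact hU z hz M (subset_refl _) (hUM z hz)
  have hUmem : ∀ z ∈ U, z ∈ T := by
    intro z hz
    rw [hFLU]; exact mem_sups.2 ⟨∅, hemptyL, z, hz, by simp⟩
  have hMF : M ∈ T := hUmem M hMU
  have hcomplM : ∀ z' ∈ complWithin M U, z' ⊆ M := by
    intro z' hz'
    obtain ⟨z, -, rfl⟩ := mem_complWithin.1 hz'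
    exact sdiff_subset
  -- the M-part of a difference inside `M`, the L-part of a difference outside `M`
  have hdiffM : ∀ w ∈ T \\ T, w ⊆ M → w ∈ complWithin M U := by
    intro w hw hwM
    rw [hDLU] at hw
    obtain ⟨x, hx, z', hz', hxz⟩ := mem_sups.1 hw
    have hxz' : x ∪ z' = ∅ ∪ w := by simpa using hxz
    obtain ⟨-, rfl⟩ := parts_eq_of_union_eq_of_disjoint (disjoint_of_subset_sdiff (hLN x hx))
      (disjoint_empty_left M) (hcomplM z' hz') hwM hxz'
    exact hz'
  have hdiffN : ∀ w ∈ T \\ T, w ⊆ S \ M → w ∈ L := by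
    intro w hw hwN
    rw [hDLU] at hw
    obtain ⟨x, hx, z', hz', hxz⟩ := mem_sups.1 hw
    have hxz' : x ∪ z' = w ∪ ∅ := by simpa using hxz
    obtain ⟨rfl, -⟩ := parts_eq_of_union_eq_of_disjoint (disjoint_of_subset_sdiff (hLN x hx))
      (disjoint_of_subset_sdiff hwN) (hcomplM z' hz') (empty_subset _) hxz'
    exact hx
  -- the extra face lies inside `M`
  have heM : e ⊆ M := by
    obtain ⟨-, t, ht, het⟩ := mem_filter.1 hef
    have hsplit : t = (t \ M) ∪ (t ∩ M) := (sdiff_union_inter t M).symm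
    have htL : t \ M ∈ L := by
      rw [hFLU] at ht
      obtain ⟨x, hx, z, hz, hxz⟩ := mem_sups.1 ht
      have hxz' : x ∪ z = (t \ M) ∪ (t ∩ M) := by rw [← hsplit]; simpa using hxz
      obtain ⟨rfl, -⟩ := parts_eq_of_union_eq_of_disjoint (disjoint_of_subset_sdiff (hLN x hx))
        disjoint_sdiff_self_left (hUM z hz) inter_subset_right hxz'
      exact hx
    have heL : e \ M ∈ L := hL _ htL _ (sdiff_subset_sdiff het (subset_refl M))
    have heMf : e ∩ M ∈ (L'.filter fun w => ∃ y ∈ T, w ⊆ y) :=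
      mem_faces_of_subset hdown hef inter_subset_left
    rcases (hfaces _).1 heMf with h | h
    · exfalso
      apply heD
      have hz' : e ∩ M ∈ complWithin M U := hdiffM _ h inter_subset_right
      rw [hDLU]
      refine mem_sups.2 ⟨e \ M, heL, e ∩ M, hz', ?_⟩
      simp [sdiff_union_inter]
    · exact inter_eq_left.1 h
  -- `u` meets every member, so `u ∩ M` is not a complement within `M` of a member of `U`
  have hmeet : ∀ t ∈ T, ¬ Disjoint u t := by
    intro t ht hdis
    apply hu
    exact hdown _ (hTU t ht) u (subset_sdiff.2 ⟨huS, hdis⟩)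
  have huM : u ∩ M ∉ complWithin M U := by
    intro h
    obtain ⟨z, hz, hzeq⟩ := mem_complWithin.1 h
    apply hmeet z (hUmem z hz)
    rw [disjoint_iff_inter_eq_empty]
    have hzM : z ⊆ M := hUM z hz
    have : u ∩ z = (u ∩ M) ∩ z := by rw [inter_assoc, inter_eq_right.2 hzM]
    rw [this, ← hzeq, inter_comm]
    exact inter_sdiff_self z M
  by_cases huML : u ∩ M ∈ L'
  · -- case (a): `u ∩ M = e`, and `e` is a member inside `u`
    have hf : u ∩ M ∈ (L'.filter fun w => ∃ y ∈ T, w ⊆ y) :=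
      mem_filter.2 ⟨huML, M, hMF, inter_subset_right⟩
    have hue : u ∩ M = e := by
      rcases (hfaces _).1 hf with h | h
      · exact absurd (hdiffM _ h inter_subset_right) huM
      · exact h
    have hMe : M \ e ∈ L' := by
      apply hdown _ huU
      rw [← hue]
      intro a ha
      rw [mem_sdiff] at ha ⊢
      exact ⟨hMS ha.1, fun hau => ha.2 (mem_inter.2 ⟨hau, ha.1⟩)⟩
    have hMef : M \ e ∈ (L'.filter fun w => ∃ y ∈ T, w ⊆ y) :=
      mem_filter.2 ⟨hMe, M, hMF, sdiff_subset⟩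
    have hMeD : M \ e ∈ T \\ T := by
      rcases (hfaces _).1 hMef with h | h
      · exact h
      · exfalso
        apply hene
        have h1 : e ∩ (M \ e) = ∅ := inter_sdiff_self e M
        rw [h, inter_self] at h1
        exact h1
    obtain ⟨z, hz, hzeq⟩ := mem_complWithin.1 (hdiffM _ hMeD sdiff_subset)
    have hez : e = z := by
      have h1 : M \ (M \ e) = e := Finset.sdiff_sdiff_eq_self heM
      have h2 : M \ (M \ z) = z := Finset.sdiff_sdiff_eq_self (hUM z hz)
      rw [← h1, ← h2, hzeq]
    refine ⟨e, hez ▸ hUmem z hz, ?_, (mem_filter.1 hef).1⟩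
    rw [← hue]; exact inter_subset_left
  · -- case (b): (Sig) at `u ∖ M` makes it a member of `L`, and `v₀` lies below a member
    have huN : u \ M ∈ L' :=
      hdown _ (hTU M hMF) _ (sdiff_subset_sdiff huS (subset_refl _))
    have huNL : u \ M ∈ L := by
      rcases hsig _ huN sdiff_subset with h | ⟨y, hy, hsub⟩
      · exact absurd (by simpa [sdiff_sdiff_right_self] using h) huML
      · have hf : u \ M ∈ (L'.filter fun w => ∃ y ∈ T, w ⊆ y) := mem_filter.2 ⟨huN, y, hy, hsub⟩
        rcases (hfaces _).1 hf with h | h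
        · exact hdiffN _ h (sdiff_subset_sdiff huS (subset_refl _))
        · exfalso
          apply hene
          have : e ⊆ M ∩ (S \ M) :=
            subset_inter heM (h ▸ sdiff_subset_sdiff huS (subset_refl M))
          rw [inter_sdiff_self] at this
          exact subset_empty.1 this
    have hv₀L : v₀ \ M ∈ L := hL _ huNL _ (sdiff_subset_sdiff hv₀u (subset_refl _))
    have hmem : (v₀ \ M) ∪ M ∈ T := by
      rw [hFLU]; exact mem_sups.2 ⟨_, hv₀L, M, hMU, rfl⟩
    exact absurd hmem
      (fun h => hv₀F _ h (by intro a ha; by_cases haM : a ∈ M <;> simp [ha, haM]))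

end PercRepro.MSTight
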